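import Mathlib
import Summits.AtomisticToContinuum.HydrodynamicLimit.Theorems.ImplosionDichotomyDenseExcursionSonicCavityDefs
import Summits.AtomisticToContinuum.HydrodynamicLimit.Theorems.ImplosionDichotomyDenseExcursionSonicRealBoundEnergy
import Summits.AtomisticToContinuum.HydrodynamicLimit.Theorems.ImplosionDichotomyDenseExcursionSonicRealBoundUnique

/-!
# Smooth radial modes of a tube profile have `Re Λ ≤ 3`
# (crux `DenseExcursion`, line `sonic-cavity-renewal`, brick for `centreContent_of_tube`)

Helper file (`--supports stmt-AtomisticToContinuum-12586`, line lead a2, stub-worker W3 for `centreContent_of_tube`).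

The landed `stub_realBound` (`…SonicRealBound`) proves `Re Λ ≤ boxSide = 100` for every smooth radial mode of a monatomic
profile in the cavity tube, but its proof (weighted energy identity `realBound_energy` with `f′ ≥ 2(Re Λ − 3)N e^{5x}`, centre
decay `realBound_centre_decay`, exterior uniqueness `realBound_unique_right`) gives verbatim the sharper bound `Re Λ ≤ 3`.
`centreContent_of_tube` quantifies over modes with `−1/4 < Re Λ ≤ 100`; this brick reduces the range to `−1/4 < Re Λ ≤ 3`, where
the inner (centre) standing-wave estimates are uniform (`|Re Λ|·eˣ/|Λ|` small on the inner region).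

Contents: `realBound_three` (registered helper). Proof copied from `stub_realBound` with `100` replaced by `3`.
-/

noncomputable section

open Filter Set
open scoped Topology ContDiff

namespace Summit.AtomisticToContinuum.HydrodynamicLimit.Theorems.SonicCavityRenewal

open Summit.AtomisticToContinuum.HydrodynamicLimit.Theorems.R2OneModeTwoConditions

-- adapted from `stub_realBound` (…SonicRealBound), threshold `100` ↦ `3`
/-- **Helper `realBound_three` for `centreContent_of_tube`: THE SHARP REAL-PART BOUND.** For a monatomic profile in the cavity
tube, every smooth radial mode has `Re Λ ≤ 3`: if `Re Λ > 3` the weighted energy `f` of `realBound_energy` has `f′ ≥ 0` on `x ≤ 1`,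
tends to `0` at `−∞` (centre decay of the regular pair) and has `f 1 ≤ 0`, hence `f ≡ 0` on `x ≤ 1`, so `f′ = 0` and
`|ŵ|² + 9|ŝ|² = 0` on `x < 1`; exterior uniqueness makes the mode trivial — contradiction. -/
theorem realBound_three : ∀ (r : ℝ) (W S : ℝ → ℝ) (Λ : ℂ) (ŵ ŝ : ℝ → ℂ), IsMonatomicProfile r W S → CavityTube r W S → IsSmoothRadialMode r W S Λ ŵ ŝ → Λ.re ≤ 3 := by
  intro r W S Λ ŵ ŝ hP hT hm
  by_contra hgt
  have h100 : (3 : ℝ) < Λ.re := not_le.mp hgt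
  obtain ⟨f, f', hf, hf', hf1, hf0⟩ := realBound_energy r W S Λ ŵ ŝ hP hT hm
  obtain ⟨C, -, hC⟩ := realBound_centre_decay ŵ ŝ hm.1
  -- `f′ ≥ 0` on `x ≤ 1`, so `f` is monotone there
  have hpos : ∀ x, x ≤ 1 → 0 ≤ f' x := by
    intro x hx
    refine le_trans ?_ (hf' x hx)
    have : 0 ≤ Λ.re - 3 := by linarith
    positivity
  have hmono : MonotoneOn f (Iic 1) :=
    monotoneOn_of_hasDerivWithinAt_nonneg (convex_Iic 1) (fun x _ => (hf x).continuousAt.continuousWithinAt)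
      (fun x _ => (hf x).hasDerivWithinAt) fun x hx => hpos x (by rw [interior_Iic] at hx; exact le_of_lt hx)
  -- `f → 0` at `−∞`
  have hlim : Tendsto f atBot (𝓝 0) := by
    have hb : ∀ᶠ x in atBot, ‖f x‖ ≤ 30 * C ^ 2 * Real.exp (2 * x) := by
      filter_upwards [eventually_le_atBot (0 : ℝ)] with x hx
      obtain ⟨hw, hs⟩ := hC x hx
      rw [Real.norm_eq_abs]
      refine (hf0 x hx).trans ?_
      have hw2 : ‖ŵ x‖ ^ 2 ≤ (C * Real.exp (-x)) ^ 2 := pow_le_pow_left₀ (norm_nonneg _) hw 2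
      have hs2 : ‖ŝ x‖ ^ 2 ≤ (C * Real.exp (-x)) ^ 2 := pow_le_pow_left₀ (norm_nonneg _) hs 2
      have he : Real.exp (2 * x) = Real.exp (4 * x) * Real.exp (-x) ^ 2 := by
        rw [sq, ← Real.exp_add, ← Real.exp_add]
        congr 1
        ring
      calc 15 * Real.exp (4 * x) * (‖ŵ x‖ ^ 2 + ‖ŝ x‖ ^ 2)
          ≤ 15 * Real.exp (4 * x) * ((C * Real.exp (-x)) ^ 2 + (C * Real.exp (-x)) ^ 2) := by gcongr
        _ = 30 * C ^ 2 * (Real.exp (4 * x) * Real.exp (-x) ^ 2) := by ring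
        _ = 30 * C ^ 2 * Real.exp (2 * x) := by rw [← he]
    refine squeeze_zero_norm' hb ?_
    have h := ((Real.tendsto_exp_atBot.comp (tendsto_id.const_mul_atBot (two_pos : (0 : ℝ) < 2))).const_mul
      (30 * C ^ 2))
    simpa using h
  -- hence `f = 0` on `x ≤ 1` and `f′ = 0` on `x < 1`
  have hzero : ∀ x, x ≤ 1 → f x = 0 := by
    intro x hx
    have hx1 : f x ≤ f 1 := hmono (show x ∈ Iic (1 : ℝ) from hx) (show (1 : ℝ) ∈ Iic 1 from Set.mem_Iic.mpr le_rfl) hx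
    refine le_antisymm (hx1.trans hf1) (le_of_tendsto hlim ?_)
    filter_upwards [eventually_le_atBot x] with y hy
    exact hmono (show y ∈ Iic (1 : ℝ) from hy.trans hx) (show x ∈ Iic (1 : ℝ) from hx) hy
  have hder : ∀ x, x < 1 → f' x = 0 := by
    intro x hx
    have h0 : HasDerivAt f 0 x := by
      refine (hasDerivAt_const x (0 : ℝ)).congr_of_eventuallyEq ?_
      filter_upwards [Iio_mem_nhds hx] with y hy using hzero y (le_of_lt hy)
    exact (hf x).unique h0
  -- so the mode vanishes on `x < 1`
  have hv : ∀ x, x < 1 → ŵ x = 0 ∧ ŝ x = 0 := by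
    intro x hx
    have h := hf' x hx.le
    rw [hder x hx] at h
    have h3 : 0 < 2 * (Λ.re - 3) := by linarith
    have hN : ‖ŵ x‖ ^ 2 + 9 * ‖ŝ x‖ ^ 2 ≤ 0 := by
      by_contra hN
      have := mul_pos (mul_pos h3 (not_le.mp hN)) (Real.exp_pos (5 * x))
      linarith
    have hw : ‖ŵ x‖ ^ 2 = 0 := by nlinarith [sq_nonneg ‖ŵ x‖, sq_nonneg ‖ŝ x‖]
    have hs : ‖ŝ x‖ ^ 2 = 0 := by nlinarith [sq_nonneg ‖ŵ x‖, sq_nonneg ‖ŝ x‖]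
    exact ⟨norm_eq_zero.mp ((pow_eq_zero_iff two_ne_zero).mp hw),
      norm_eq_zero.mp ((pow_eq_zero_iff two_ne_zero).mp hs)⟩
  -- and everywhere, contradicting non-triviality
  have hall := realBound_unique_right r W S Λ ŵ ŝ hP hT hm hv
  obtain ⟨x₀, hx₀⟩ := hm.2.1
  exact hx₀.elim (fun h => h (hall x₀).1) fun h => h (hall x₀).2

end Summit.AtomisticToContinuum.HydrodynamicLimit.Theorems.SonicCavityRenewal

end
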